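import Mathlib

/-!
# Friedlander–Iwaniec 2025, «On the Bombieri–Davenport large sieve inequalities», §3
# «The large sieve with an exceptional character» — Propositions 3.1 and 3.2 (NAMED FACTS)

J. Friedlander, H. Iwaniec, *On the Bombieri–Davenport large sieve inequalities*, Rend. Lincei
Mat. Appl. 36 (2025) 485–499, doi:10.4171/rlm/1079 (received 25 October 2024, accepted 1 July 2025;
CC BY 4.0). Held: `paper:doi-10-4171-rlm-1079`. Cell landau-siegel §C row P-608 / T-330 (tag DH).

Setting of §3 (pp. 493–494): `χ_D` is «a second real character, say `χ_D` of conductor `D`» — a real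
PRIMITIVE Dirichlet character of conductor `D` (rendered `IsQuadratic ∧ IsPrimitive` of modulus `D`);
`L(1, χ_D)` is its (real, positive) value at `1`, rendered `(χ_D.LFunction 1).re` as everywhere in the
tree (`siegel_lower_bound`). Prime sums `∑_{n ≤ N} χ(n) Λ(n)` are `∑ n ∈ Icc 1 N, χ n * Λ n` (complex).
The inner sums of (3.11)/(3.12) run over PRIMITIVE characters `χ (mod q)`, `χ ≠ χ_D` — the primitivity
is inherited from (3.1) = Theorem 8 of Bombieri–Davenport 1969 [2] (weights `log(Q/q)`, `1 < q ≤ Q`,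
primitive `χ`) and is explicit in the wording of Proposition 3.2.
«`χ ≠ χ_D`» across moduli is rendered as inequality of the two characters AS FUNCTIONS ON `ℕ`.

Nothing is proved here: both statements are `def … : Prop` NAMED FACTS with the print as the only
source. Tag DH (cell landau-siegel §C): an explicit Deuring–Heilbronn-type repulsion in LARGE-SIEVE form
(a small `L(1, χ_D)` forces every other primitive prime sum to be small), uniform in `q ≤ N^{1/4}` — a
relative of the zero-repulsion facts `deuringHeilbronn` (`DeuringHeilbronn.lean`, class group
`L`-functions, pair form), `deuringHeilbronn_moderate` (`DHPositivity.lean`) and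
`deuringHeilbronn_congruence` (`RayClassDeuringHeilbronn.lean`); it is NOT a mollifier-length input
(`E*-len`): a better large-sieve constant or weight cannot move the margin of arXiv:2211.02515 §2.
FRAMING: the programme SEARCHES and TYPES; no claim about Landau–Siegel zeros, Theorems 1–2
of arXiv:2211.02515 or a repaired Margin232 until a kernel theorem says so.
-/

open Finset
open scoped ArithmeticFunction.vonMangoldt Classical

namespace Literature.NumberTheory.LFunctions

namespace FriedlanderIwaniec2025

/-- The prime sum `∑_{n ≤ N} χ(n) Λ(n)` of a Dirichlet character (a complex number).
[cite: FriedlanderIwaniec2025BombieriDavenport, §3 (3.2) with `f = 1`, p. 494] -/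
noncomputable def primeSum {q : ℕ} (χ : DirichletCharacter ℂ q) (N : ℕ) : ℂ :=
  ∑ n ∈ Icc 1 N, χ (n : ZMod q) * (Λ n : ℂ)

/-- «`χ ≠ χ_D`» for characters of possibly different moduli: the two characters differ as
functions on `ℕ`. [cite: FriedlanderIwaniec2025BombieriDavenport, §3 p. 495–496] -/
def NeAsFun {q D : ℕ} (χ : DirichletCharacter ℂ q) (χD : DirichletCharacter ℂ D) : Prop :=
  (fun n : ℕ => χ (n : ZMod q)) ≠ fun n : ℕ => χD (n : ZMod D)

/-- The weighted large-sieve sum of (3.12): `∑_{1 < q ≤ Q} log(Q/q) ∑*_{χ mod q, χ ≠ χ_D} |∑_{n≤N} χ(n)Λ(n)|²`,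
moduli `q = i + 2`, `i < ⌊Q⌋₊ - 1`, primitive `χ` only (asterisk of (3.1)).
[cite: FriedlanderIwaniec2025BombieriDavenport, Proposition 3.1 (3.12) p. 495] -/
noncomputable def weightedLargeSieveSum {D : ℕ} (χD : DirichletCharacter ℂ D) (Q : ℝ) (N : ℕ) : ℝ :=
  ∑ i ∈ range (⌊Q⌋₊ - 1), Real.log (Q / ((i + 2 : ℕ) : ℝ)) *
    ∑ χ : DirichletCharacter ℂ (i + 2),
      if χ.IsPrimitive ∧ NeAsFun χ χD then ‖primeSum χ N‖ ^ 2 else 0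

end FriedlanderIwaniec2025

open FriedlanderIwaniec2025

/-- **Friedlander–Iwaniec 2025, Proposition 3.1 (NAMED FACT, as printed).** "Let `3 ≤ D ≤ Q = √N / log N`.
We have `∑_{1<q≤Q} log(Q/q) ∑*_{χ (mod q), χ ≠ χ_D} |∑_{n≤N} χ(n)Λ(n)|² ≤ N² (log cD + L(1,χ_D)(log N)²)`,
where `c > 1` is an absolute constant." (`χ_D` a real primitive character of conductor `D`; the
asterisk = primitive characters, from (3.1).) Not proved here.
[cite: FriedlanderIwaniec2025BombieriDavenport, Proposition 3.1 (3.12) p. 495] -/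
def friedlanderIwaniec2025_prop31 : Prop :=
  ∃ c : ℝ, 1 < c ∧ ∀ (N : ℕ) (D : ℕ) [NeZero D], 3 ≤ D →
    (D : ℝ) ≤ Real.sqrt N / Real.log N →
    ∀ χD : DirichletCharacter ℂ D, χD.IsQuadratic → χD.IsPrimitive →
      weightedLargeSieveSum χD (Real.sqrt N / Real.log N) N ≤
        (N : ℝ) ^ 2 * (Real.log (c * D) + (χD.LFunction 1).re * Real.log N ^ 2)

/-- **Friedlander–Iwaniec 2025, Proposition 3.2 (NAMED FACT, as printed).** "Let `D` be larger than a
suitable absolute constant. Suppose `L(1,χ_D) log D ≤ ε⁵` (3.13). Then, for every primitive character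
`χ (mod q)`, `χ ≠ χ₀, χ_D` and every `N ≥ q⁴` with `D^{1/ε²} < N < D^{1/ε³}`, we have
`|∑_{n≤N} χ(n)Λ(n)| ≤ 3εN` (3.14)." The absolute constant `D₀` is not specified in print and does not
depend on `ε` (`∃ D₀` outermost); `ε > 0` is implicit (for `ε ≥ 1` the window is empty). Not proved
here. The printed four-line proof from (3.12) («`Q/q ≥ N^{1/4}/log N`, hence `9 log D/(2 log N) + ε⁵ log N/log D
< 9ε²`») addresses the intended regime of small `ε` (it needs `D ≤ Q = √N/log N`, automatic from `D < N^{ε²}`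
when `ε² ≤ 0.12`); for `3ε ≥ 1.03883` the bound is trivial from `ψ(N) < 1.03883 N` (Rosser–Schoenfeld 1962,
Theorem 12), so the statement holds as typed with an absolute `D₀`.
[cite: FriedlanderIwaniec2025BombieriDavenport, Proposition 3.2 (3.13)–(3.14) p. 496] -/
def friedlanderIwaniec2025_prop32 : Prop :=
  ∃ D₀ : ℝ, ∀ (D : ℕ) [NeZero D], D₀ ≤ D →
    ∀ χD : DirichletCharacter ℂ D, χD.IsQuadratic → χD.IsPrimitive →
      ∀ ε : ℝ, 0 < ε → (χD.LFunction 1).re * Real.log D ≤ ε ^ 5 →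
        ∀ (q : ℕ) [NeZero q] (χ : DirichletCharacter ℂ q), χ.IsPrimitive → χ ≠ 1 → NeAsFun χ χD →
          ∀ N : ℕ, (q : ℝ) ^ 4 ≤ N → (D : ℝ) ^ (1 / ε ^ 2) < N → (N : ℝ) < (D : ℝ) ^ (1 / ε ^ 3) →
            ‖primeSum χ N‖ ≤ 3 * ε * N

end Literature.NumberTheory.LFunctions
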